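import Literature.Analysis.FluidPDE.ForwardDSSLocalEnergy
import HarnessLib

/-!
# Forward DSS solutions: the running essential supremum of the local energy and the
  continuity argument for merely measurable energies

Analysis/FluidPDE proof file (theorems only, no new definitions) under the named fact
`Literature.Analysis.FluidPDE.bradshawTsai2019_prop_3_1` (Bradshaw–Tsai, Analysis & PDE 12
(2019) = arXiv:1801.08060, Prop. 3.1; `ForwardDSSExistence.lean`). The printed proof of
Prop. 3.1 closes the a priori estimate

> (3.13) `α(t) ≤ α₀ + C ∫₀ᵗ (α̃(s)³ + α̃(s)) ds`, `α̃(t) = sup_{0≤τ≤t} α(τ)`,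

by "a continuity argument" (p. 10), which uses that for the *smooth approximants* `v_ε` the
local energy `α_ε(t) = ∫_{B₁}|v_ε(t)|²` is continuous (p. 8). For a general local Leray solution
`t ↦ ∫_{B₁}|v(t)|²` is only measurable and essentially bounded, and the local energy
inequality holds at almost every time. This file supplies the form of the continuity argument
that such data allow, with the running **essential** supremum
`α̃(s) = esssup_{0<τ<s} α(τ)` (Mathlib's `essSup α (volume.restrict (Ioo 0 s))`, written out;
no definition is introduced):

* `ae_comp_mul_left`, `ae_forall_comp_mul_left` — almost-everywhere statements on the time axis
  pull back along the dilations `σ ↦ κσ` (`κ ≠ 0`), countably many at once (the DSS rescalings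
  `t ↦ λ^{-2k} t` of (3.6));
* `essSup_Ioo_mono`, `measurable_essSup_Ioo`, `essSup_Ioo_le_of_ae_le` — `α̃` is monotone (hence
  measurable) and inherits essential bounds of `α`;
* `ae_le_essSup_Ioo`, `ae_forall_mul_le_essSup_Ioo` — for a.e. `σ > 0`, `α(σ) ≤ α̃(s)` for every
  `s > σ`, and `α(κᵢσ) ≤ α̃(σ)` simultaneously for countably many ratios `κᵢ ∈ (0,1)`;
* `continuity_argument_ae` — **the continuity argument for an a.e. integral inequality**: if
  `α ≤ B < ∞` a.e. on `(0,1)` and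
  `α(s) + D(s) ≤ M + K ∫₀ˢ (α̃(σ)³ + α̃(σ)) dσ` for a.e. `s ∈ (0,1)` (`M, K < ∞`, `D ≥ 0`
  arbitrary), then for `0 < T ≤ 1` with `K T (2 + 8(M+1)²) < 1`:
  `α̃(T) ≤ 2(M+1)`, `M + K∫₀ᵀ(α̃³ + α̃) ≤ 2(M+1)` and `α(s) + D(s) ≤ 2(M+1)` for a.e. `s ∈ (0,T)`.
  Proof: the right-hand side `F(t) = M + K∫₀^{min(t,1)}(α̃³ + α̃)` is finite, monotone and
  (Lipschitz) continuous with `F(0) = M`; `α ≤ F` a.e. gives `α̃ ≤ F` on `(0,1]`, so `F` obeys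
  (3.13) with its own running supremum and the accepted `BradshawTsai2019.continuity_argument`
  (`ForwardDSSLocalEnergy.lean`) applies to `F`.

These are the measure-theoretic steps of the tree's proof that Prop. 3.1 holds for **every**
`λ`-DSS local Leray solution (files `ForwardDSSAprioriUniversal*`).

## References

* Z. Bradshaw, T.-P. Tsai, Analysis & PDE 12 (2019) 1943–1962 = arXiv:1801.08060, §3, proof of
  Prop. 3.1, (3.13)–(3.14) (p. 10) [BradshawTsai2019].
-/

noncomputable section

open MeasureTheory Set Function Filter Topology TopologicalSpace Metric
open scoped NNReal ENNReal

namespace Literature.Analysis.FluidPDE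

namespace BradshawTsai2019

/-! ## Pull-back of a.e. statements along dilations of the time axis -/

/-- An almost-everywhere property of times pulls back along `σ ↦ κσ`, `κ ≠ 0` (Lebesgue measure
is quasi-invariant under dilations). [folklore] -/
theorem ae_comp_mul_left {P : ℝ → Prop} (h : ∀ᵐ σ ∂(volume : Measure ℝ), P σ) {κ : ℝ}
    (hκ : κ ≠ 0) : ∀ᵐ σ ∂(volume : Measure ℝ), P (κ * σ) := by
  rw [ae_iff] at h ⊢
  have e : {σ : ℝ | ¬P (κ * σ)} = (fun σ => κ * σ) ⁻¹' {σ | ¬P σ} := rfl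
  rw [e, Real.volume_preimage_mul_left hκ, h, mul_zero]

/-- Countably many dilations at once. [folklore] -/
theorem ae_forall_comp_mul_left {ι : Type*} [Countable ι] {P : ℝ → Prop}
    (h : ∀ᵐ σ ∂(volume : Measure ℝ), P σ) {κ : ι → ℝ} (hκ : ∀ i, κ i ≠ 0) :
    ∀ᵐ σ ∂(volume : Measure ℝ), ∀ i, P (κ i * σ) :=
  ae_all_iff.2 fun i => ae_comp_mul_left h (hκ i)

/-! ## The running essential supremum `α̃(s) = esssup_{0<τ<s} α(τ)` -/

/-- `α̃` is monotone in the time. [folklore] -/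
theorem essSup_Ioo_mono (α : ℝ → ℝ≥0∞) {s s' : ℝ} (h : s ≤ s') :
    essSup α (volume.restrict (Ioo 0 s)) ≤ essSup α (volume.restrict (Ioo 0 s')) :=
  essSup_mono_measure
    (Measure.absolutelyContinuous_of_le (Measure.restrict_mono (Ioo_subset_Ioo_right h) le_rfl))

/-- `α̃` is monotone. [folklore] -/
theorem monotone_essSup_Ioo (α : ℝ → ℝ≥0∞) :
    Monotone fun s => essSup α (volume.restrict (Ioo 0 s)) :=
  fun _ _ h => essSup_Ioo_mono α h

/-- `α̃` is measurable (it is monotone). [folklore] -/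
theorem measurable_essSup_Ioo (α : ℝ → ℝ≥0∞) :
    Measurable fun s => essSup α (volume.restrict (Ioo 0 s)) :=
  (monotone_essSup_Ioo α).measurable

/-- An essential bound of `α` on `(0,T)` bounds `α̃(s)` for `s ≤ T`. [folklore] -/
theorem essSup_Ioo_le_of_ae_le {α : ℝ → ℝ≥0∞} {T : ℝ} {C : ℝ≥0∞}
    (h : ∀ᵐ σ ∂(volume.restrict (Ioo 0 T)), α σ ≤ C) {s : ℝ} (hs : s ≤ T) :
    essSup α (volume.restrict (Ioo 0 s)) ≤ C :=
  essSup_le_of_ae_le C (ae_restrict_of_ae_restrict_of_subset (Ioo_subset_Ioo_right hs) h)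

/-- **`α ≤ α̃` in the almost-everywhere sense**: for a.e. `σ > 0`, `α(σ) ≤ α̃(s)` for every
`s > σ` (through a rational time between `σ` and `s`). [folklore] -/
theorem ae_le_essSup_Ioo (α : ℝ → ℝ≥0∞) :
    ∀ᵐ σ ∂(volume : Measure ℝ), 0 < σ → ∀ s : ℝ, σ < s →
      α σ ≤ essSup α (volume.restrict (Ioo 0 s)) := by
  have hq : ∀ q : ℚ, ∀ᵐ σ ∂(volume : Measure ℝ), σ ∈ Ioo (0 : ℝ) q →
      α σ ≤ essSup α (volume.restrict (Ioo 0 (q : ℝ))) := fun q =>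
    (ae_restrict_iff' measurableSet_Ioo).1 (ENNReal.ae_le_essSup α)
  filter_upwards [ae_all_iff.2 hq] with σ hσ hσ0 s hσs
  obtain ⟨q, hσq, hqs⟩ := exists_rat_btwn hσs
  exact (hσ q ⟨hσ0, hσq⟩).trans (essSup_Ioo_mono α hqs.le)

/-- **The rescaled energies are dominated by the running supremum**: for countably many ratios
`κᵢ ∈ (0,1)`, for a.e. `σ > 0` one has `α(κᵢσ) ≤ α̃(σ)` for all `i` (Bradshaw–Tsai 2019, p. 9:
"the right hand side determined at time `λ⁻⁴s`", bounded by `α̃_ε(s)`). [cite: BradshawTsai2019, §3 p. 9 ((3.6) and the use of α̃)] -/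
theorem ae_forall_mul_le_essSup_Ioo (α : ℝ → ℝ≥0∞) {ι : Type*} [Countable ι] {κ : ι → ℝ}
    (hκ0 : ∀ i, 0 < κ i) (hκ1 : ∀ i, κ i < 1) :
    ∀ᵐ σ ∂(volume : Measure ℝ), 0 < σ → ∀ i,
      α (κ i * σ) ≤ essSup α (volume.restrict (Ioo 0 σ)) := by
  have h := ae_forall_comp_mul_left (ae_le_essSup_Ioo α) fun i => (hκ0 i).ne'
  filter_upwards [h] with σ hσ hσ0 i
  exact hσ i (mul_pos (hκ0 i) hσ0) σ (mul_lt_of_lt_one_left hσ0 (hκ1 i))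

/-! ## The continuity argument for an a.e. integral inequality -/

/-- `min t' 1 - min t 1 ≤ t' - t` for `t ≤ t'`. [folklore] -/
theorem min_one_sub_min_one_le {t t' : ℝ} (h : t ≤ t') : min t' 1 - min t 1 ≤ t' - t := by
  rcases le_total t 1 with ht | ht
  · rw [min_eq_left ht]
    linarith [min_le_left t' 1]
  · rw [min_eq_right ht, min_eq_right (ht.trans h)]
    linarith

/-- **The continuity argument of Bradshaw–Tsai 2019 for measurable energies** ((3.13) ⇒ (3.14),
arXiv:1801.08060 p. 10, with the running essential supremum). Let `α, D : ℝ → [0,∞]`, let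
`α ≤ B < ∞` a.e. on `(0,1)`, and suppose that for a.e. `s ∈ (0,1)`
`α(s) + D(s) ≤ M + K ∫₀ˢ (α̃(σ)³ + α̃(σ)) dσ` with `α̃(σ) = esssup_{0<τ<σ} α(τ)` and `M, K < ∞`.
If `0 < T ≤ 1` and `K T (2 + 8(M+1)²) < 1`, then `α̃(T) ≤ 2(M+1)`,
`M + K∫₀ᵀ(α̃³ + α̃) ≤ 2(M+1)`, and `α(s) + D(s) ≤ 2(M+1)` for a.e. `s ∈ (0,T)`. (The bound
`F(t) = M + K∫₀^{min(t,1)}(α̃³ + α̃)` is finite, monotone and Lipschitz with `F(0) = M`; `α ≤ F`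
a.e. forces `α̃ ≤ F`, so `F` satisfies (3.13) and the printed continuity argument
`BradshawTsai2019.continuity_argument` applies to it with `a = M + 1`.) [cite: BradshawTsai2019, §3 proof of Prop 3.1 ((3.13)–(3.14), p. 10)] -/
theorem continuity_argument_ae {α D : ℝ → ℝ≥0∞} {M K B : ℝ≥0∞} (hM : M ≠ ⊤) (hK : K ≠ ⊤)
    (hB : B ≠ ⊤) (hαB : ∀ᵐ σ ∂(volume.restrict (Ioo (0 : ℝ) 1)), α σ ≤ B)
    (hineq : ∀ᵐ s ∂(volume.restrict (Ioo (0 : ℝ) 1)),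
      α s + D s ≤ M + K * ∫⁻ σ in Ioo 0 s,
        (essSup α (volume.restrict (Ioo 0 σ)) ^ 3 + essSup α (volume.restrict (Ioo 0 σ))))
    {T : ℝ} (hT0 : 0 < T) (hT1 : T ≤ 1)
    (hsmall : K * ENNReal.ofReal T * (2 + 8 * (M + 1) ^ 2) < 1) :
    essSup α (volume.restrict (Ioo 0 T)) ≤ 2 * (M + 1) ∧
    M + K * ∫⁻ σ in Ioo 0 T,
        (essSup α (volume.restrict (Ioo 0 σ)) ^ 3 + essSup α (volume.restrict (Ioo 0 σ))) ≤
      2 * (M + 1) ∧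
    ∀ᵐ s ∂(volume.restrict (Ioo (0 : ℝ) T)), α s + D s ≤ 2 * (M + 1) := by
  -- the running supremum `E`, the integrand `h = E³ + E` and its bound `B' = B³ + B` on `(0,1]`
  set E : ℝ → ℝ≥0∞ := fun σ => essSup α (volume.restrict (Ioo 0 σ)) with hE
  have hEmono : Monotone E := monotone_essSup_Ioo α
  have hEB : ∀ σ, σ ≤ 1 → E σ ≤ B := fun σ hσ => essSup_Ioo_le_of_ae_le hαB hσ
  set h : ℝ → ℝ≥0∞ := fun σ => E σ ^ 3 + E σ with hh
  have hhmeas : Measurable h :=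
    ((measurable_essSup_Ioo α).pow_const 3).add (measurable_essSup_Ioo α)
  set B' : ℝ≥0∞ := B ^ 3 + B with hB'
  have hB'top : B' ≠ ⊤ := ENNReal.add_ne_top.2 ⟨ENNReal.pow_ne_top hB, hB⟩
  have hhB : ∀ σ, σ ≤ 1 → h σ ≤ B' := fun σ hσ =>
    add_le_add (pow_le_pow_left' (hEB σ hσ) 3) (hEB σ hσ)
  -- `Φ(t) = ∫₀^{min(t,1)} h` and `F = M + K Φ`
  set Φ : ℝ → ℝ≥0∞ := fun t => ∫⁻ σ in Ioo 0 (min t 1), h σ with hΦ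
  have hΦmono : Monotone Φ := fun t t' htt' =>
    lintegral_mono_set (Ioo_subset_Ioo_right (min_le_min_right 1 htt'))
  have hΦle : ∀ t, Φ t ≤ B' * ENNReal.ofReal (min t 1) := by
    intro t
    calc Φ t ≤ ∫⁻ _ in Ioo 0 (min t 1), B' :=
          setLIntegral_mono' measurableSet_Ioo fun σ hσ => hhB σ (hσ.2.le.trans (min_le_right _ _))
      _ = B' * ENNReal.ofReal (min t 1) := by rw [setLIntegral_const, Real.volume_Ioo, sub_zero]
  have hΦtop : ∀ t, Φ t ≠ ⊤ := fun t =>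
    ne_top_of_le_ne_top (ENNReal.mul_ne_top hB'top ENNReal.ofReal_ne_top) (hΦle t)
  -- the increment bound `Φ t' ≤ Φ t + B' (t' - t)`
  have hΦinc : ∀ t t', t ≤ t' → Φ t' ≤ Φ t + B' * ENNReal.ofReal (t' - t) := by
    intro t t' htt'
    have hsub : Ioo 0 (min t' 1) ⊆ Ioo 0 (min t 1) ∪ Ico (min t 1) (min t' 1) := by
      intro σ hσ
      by_cases h1 : σ < min t 1
      · exact Or.inl ⟨hσ.1, h1⟩
      · exact Or.inr ⟨not_lt.1 h1, hσ.2⟩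
    calc Φ t' ≤ ∫⁻ σ in Ioo 0 (min t 1) ∪ Ico (min t 1) (min t' 1), h σ := lintegral_mono_set hsub
      _ ≤ Φ t + ∫⁻ σ in Ico (min t 1) (min t' 1), h σ := lintegral_union_le _ _ _
      _ ≤ Φ t + ∫⁻ _ in Ico (min t 1) (min t' 1), B' :=
          add_le_add le_rfl (setLIntegral_mono' measurableSet_Ico fun σ hσ =>
            hhB σ (hσ.2.le.trans (min_le_right _ _)))
      _ = Φ t + B' * ENNReal.ofReal (min t' 1 - min t 1) := by
          rw [setLIntegral_const, Real.volume_Ico]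
      _ ≤ Φ t + B' * ENNReal.ofReal (t' - t) :=
          add_le_add le_rfl (mul_le_mul' le_rfl
            (ENNReal.ofReal_le_ofReal (min_one_sub_min_one_le htt')))
  -- continuity of `Φ` (Lipschitz through `toReal`)
  have hΦcont : Continuous Φ := by
    set φ : ℝ → ℝ := fun t => (Φ t).toReal with hφ
    have hΦeq : Φ = fun t => ENNReal.ofReal (φ t) := by
      funext t; rw [hφ, ENNReal.ofReal_toReal (hΦtop t)]
    have hlip : LipschitzWith B'.toNNReal φ := by
      refine LipschitzWith.of_le_add_mul _ fun x y => ?_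
      rcases le_total x y with hxy | hxy
      · -- `φ x ≤ φ y`
        have : φ x ≤ φ y := ENNReal.toReal_mono (hΦtop y) (hΦmono hxy)
        exact this.trans (le_add_of_nonneg_right (mul_nonneg B'.toNNReal.coe_nonneg dist_nonneg))
      · have h1 := hΦinc y x hxy
        have h2 : φ x ≤ (Φ y + B' * ENNReal.ofReal (x - y)).toReal :=
          ENNReal.toReal_mono (ENNReal.add_ne_top.2
            ⟨hΦtop y, ENNReal.mul_ne_top hB'top ENNReal.ofReal_ne_top⟩) h1
        rw [ENNReal.toReal_add (hΦtop y) (ENNReal.mul_ne_top hB'top ENNReal.ofReal_ne_top),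
          ENNReal.toReal_mul, ENNReal.toReal_ofReal (sub_nonneg.2 hxy)] at h2
        refine h2.trans (add_le_add le_rfl ?_)
        rw [Real.dist_eq, abs_of_nonneg (sub_nonneg.2 hxy)]
        rfl
    rw [hΦeq]
    exact ENNReal.continuous_ofReal.comp hlip.continuous
  set F : ℝ → ℝ≥0∞ := fun t => M + K * Φ t with hF
  have hFmono : Monotone F := fun t t' htt' => add_le_add le_rfl (mul_le_mul' le_rfl (hΦmono htt'))
  have hFcont : Continuous F := continuous_const.add (ENNReal.continuous_const_mul hK |>.comp hΦcont)
  have hF0 : F 0 = M := by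
    simp only [hF, hΦ, min_eq_left (zero_le_one (α := ℝ)), Ioo_self, Measure.restrict_empty,
      lintegral_zero_measure, mul_zero, add_zero]
  have hFtop : ∀ t, F t ≠ ⊤ := fun t =>
    ENNReal.add_ne_top.2 ⟨hM, ENNReal.mul_ne_top hK (hΦtop t)⟩
  -- `F s = M + K ∫₀ˢ h` for `s ≤ 1`
  have hFs : ∀ s, s ≤ 1 → F s = M + K * ∫⁻ σ in Ioo 0 s, h σ := fun s hs => by
    simp only [hF, hΦ, min_eq_left hs]
  -- `α ≤ F` a.e. on `(0,1)`, hence `E ≤ F` on `(0,1]`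
  have hαF : ∀ᵐ s ∂(volume.restrict (Ioo (0 : ℝ) 1)), α s ≤ F s := by
    filter_upwards [hineq, ae_restrict_mem measurableSet_Ioo] with s hs hsI
    rw [hFs s hsI.2.le]
    exact le_self_add.trans hs
  have hEF : ∀ t, t ∈ Ioc (0 : ℝ) 1 → E t ≤ F t := by
    intro t ht
    refine essSup_le_of_ae_le (F t) ?_
    have h1 : ∀ᵐ s ∂(volume.restrict (Ioo (0 : ℝ) t)), α s ≤ F s :=
      ae_restrict_of_ae_restrict_of_subset (Ioo_subset_Ioo_right ht.2) hαF
    filter_upwards [h1, ae_restrict_mem measurableSet_Ioo] with s hs hsI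
    exact hs.trans (hFmono hsI.2.le)
  -- `F` satisfies (3.13) with its own running supremum
  have hsupF : ∀ s, 0 < s → (⨆ τ ∈ Ioc (0 : ℝ) s, F τ) = F s := fun s hs =>
    le_antisymm (iSup₂_le fun τ hτ => hFmono hτ.2) (le_iSup₂ (f := fun τ (_ : τ ∈ Ioc (0 : ℝ) s) => F τ) s ⟨hs, le_rfl⟩)
  have hineqF : ∀ t ∈ Ioc (0 : ℝ) 1,
      F t ≤ M + K * ∫⁻ s in Ioo 0 t, ((⨆ τ ∈ Ioc (0 : ℝ) s, F τ) ^ 3 + ⨆ τ ∈ Ioc (0 : ℝ) s, F τ) := by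
    intro t ht
    rw [hFs t ht.2]
    gcongr M + K * ?_
    refine setLIntegral_mono' measurableSet_Ioo fun s hs => ?_
    rw [hsupF s hs.1]
    have hEs : E s ≤ F s := hEF s ⟨hs.1, hs.2.le.trans ht.2⟩
    exact add_le_add (pow_le_pow_left' hEs 3) hEs
  -- the printed continuity argument, applied to `F`
  set a : ℝ≥0∞ := M + 1 with ha
  have ha0 : a ≠ 0 := by rw [ha]; exact (lt_of_lt_of_le zero_lt_one le_add_self).ne'
  have hatop : a ≠ ⊤ := ENNReal.add_ne_top.2 ⟨hM, ENNReal.one_ne_top⟩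
  have hkey := continuity_argument (α := F) (α₀ := M) (a := a) (C₀ := K) (l := M) (T := T) hT1
    le_self_add ha0 hatop hsmall hFcont.continuousOn le_rfl
    (by simpa only [hF0] using (hFcont.tendsto 0).mono_left nhdsWithin_le_nhds) hineqF
  have hFT : F T ≤ 2 * a := hkey T ⟨hT0, le_rfl⟩
  refine ⟨(hEF T ⟨hT0, hT1⟩).trans hFT, ?_, ?_⟩
  · rw [← hFs T hT1]
    exact hFT
  · have h1 : ∀ᵐ s ∂(volume.restrict (Ioo (0 : ℝ) T)),
        α s + D s ≤ M + K * ∫⁻ σ in Ioo 0 s, h σ :=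
      ae_restrict_of_ae_restrict_of_subset (Ioo_subset_Ioo_right hT1) hineq
    filter_upwards [h1, ae_restrict_mem measurableSet_Ioo] with s hs hsI
    have hs1 : s ≤ 1 := hsI.2.le.trans hT1
    calc α s + D s ≤ M + K * ∫⁻ σ in Ioo 0 s, h σ := hs
      _ = F s := (hFs s hs1).symm
      _ ≤ F T := hFmono hsI.2.le
      _ ≤ 2 * a := hFT

end BradshawTsai2019

end Literature.Analysis.FluidPDE

end
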